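import Summits.MatrixMultiplication.MatrixMultiplication.Theses.SnSubsetDichotomy
import Literature.RepresentationTheory.FiniteGroups.SymmetricGroupCosetSpanProofs
import Literature.RepresentationTheory.FiniteGroups.SymmetricGroupIsotypic
import Literature.Barriers.MatrixMultiplication.QuasirandomBarrierProofs
import Literature.Barriers.ValiantsHypothesis.GCTMatrixPoweringProp17OnlyIf
import Summits.MatrixMultiplication.MatrixMultiplication.Theorems.LevelGradedCohnUmansLevelOneLinkPermModule

/-!
# Stub `stub_umvirateParseval` (crux stmt-MatrixMultiplication-8303, line flat-tail-truncation)

Crux `Summit.MatrixMultiplication.MatrixMultiplication.Theses.SnSubsetDichotomy.GlobalBranch`, line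
`flat-tail-truncation`: **the umvirate Parseval inequality** (Young's rule content), the bridge
between the spectral flatness of the line and the combinatorial `L²`-flatness of umvirate
densities. For `ℓ ≤ n` and every `f : 𝔖ₙ → ℂ`,
`Σ_{μ ≠ (n), μ₁ ≥ n-ℓ} Re Σ_{x,y} f̄(x) f(y) χ^μ(x⁻¹y) ≤ Σ_{I,L} |f(U_{I→L})|² - |f(𝔖ₙ)|²`, where
`U_{I→L} = {σ : σ ∘ I = L}` for injective `ℓ`-tuples `I, L : Fin ℓ ↪ Fin n`.

Proof. Let `Ω = Fin ℓ ↪ Fin n` with `(σ • I) k = σ (I k)`, `P = ℂ[Ω]` (`Representation.ofMulAction`)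
and `ψ = χ_P`. (1) Double counting (`umvirateParseval_sum_norm_sq_eq`, any finite `G`-set):
`Σ_{a,b} |Σ_{σ • a = b} f(σ)|² = Σ_{x,y} f̄(x) f(y) #{a : (x⁻¹y) • a = a}`, and `ψ` counts fixed
points (`umvirateParseval_character_ofMulAction`). (2) `ψ = Σ_{ν ⊢ n} ⟨ψ, χ^ν⟩ χ^ν`
(completeness, `umvirateParseval_classFun_eq_sum`). (3) `⟨ψ, χ^ν⟩ = rk P_{χ^ν} / dim S^ν ≥ 0`
(the isotypic projector of `ℂ[Ω]` is idempotent of trace `χ^ν(1)⟨χ^ν, ψ⟩`;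
`umvirateParseval_classInner_coeff`), and `≥ 1` when `ν₁ ≥ n - ℓ`: **Young's rule, lower bound**
(`umvirateParseval_finrank_le_rank`, as in Ellis–Friedgut–Pilpel 2011, proof of Thm. 7: the
stabiliser of an `ℓ`-tuple whose complement lies in the first row of the canonical tableau consists
of row permutations, hence fixes the Young symmetrizer `c_ν ≠ 0`, whose orbit map is an
equivariant surjection `ℂ[Ω] ↠ S^ν`; tree `EllisFriedgutPilpel2011.mem_rowStabilizer_of_fix`,
`LevelOneLink.orbitMap_surjective`, `LevelOneLink.finrank_le_finrank_range_isotypicProj`). The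
partition `(n)` (`χ^{(n)} = 1`) has coefficient `≥ 1`, which pays for `|f(𝔖ₙ)|²`. (4) Every
`Re Σ_{x,y} f̄(x) f(y) χ(x⁻¹y)` is `≥ 0` (`umvirateParseval_re_charSum_nonneg`: `tr(Aᴴ A)` in a
unitary matrix form). Hence `Σ_{I,L} |f(U_{I→L})|² = Σ_ν ⟨ψ, χ^ν⟩ Re B_ν ≥ Σ_{ν₁ ≥ n-ℓ} Re B_ν`.
-/

set_option linter.dupNamespace false

open scoped BigOperators Matrix ComplexOrder
open Finset
open Literature.NumberTheory.DiophantineGeometry (numStandardTableaux spechtCharacter)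

namespace Summit.MatrixMultiplication.MatrixMultiplication.Theorems.GlobalBranch

open Module Literature.RepresentationTheory.FiniteGroups Literature.Barriers.MatrixMultiplication
open Literature.NumberTheory.DiophantineGeometry (spechtRep spechtIdeal youngSymmetrizer
  rowSymmetrizer rowStabilizer youngSymmetrizer_mem_spechtIdeal spechtRep_apply
  youngSymmetrizer_ne_zero_holds isIrreducible_spechtRep_holds)

/-! ### Positivity of character sums `Σ_{x,y} f̄(x) f(y) χ(x⁻¹y)` -/

section Positivity

variable {G : Type} [Group G] [Fintype G] {V : Type*} [AddCommGroup V] [Module ℂ V]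
  [FiniteDimensional ℂ V]

-- adapted from `star_character_apply` (SymmetricGroupIsotypic.lean): unitary matrix form
/-- **Characters are positive definite functions**: for the character `χ` of a finite-dimensional
complex representation of a finite group and any `f : G → ℂ`,
`Re Σ_{x,y} f̄(x) f(y) χ(x⁻¹y) ≥ 0`. In a unitary matrix form `M` of the representation
(Weyl's unitarian trick, `exists_conj_unitary`) one has `M(x⁻¹) = M(x)ᴴ`, so the sum is
`tr(Aᴴ A)` with `A = Σ_y f(y) M(y)`. [folklore] -/
theorem umvirateParseval_re_charSum_nonneg (ρ : Representation ℂ G V) (f : G → ℂ) :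
    0 ≤ (∑ x : G, ∑ y : G, (starRingEnd ℂ) (f x) * f y * ρ.character (x⁻¹ * y)).re := by
  classical
  set b := Module.finBasis ℂ V
  set R : G →* Matrix (Fin (finrank ℂ V)) (Fin (finrank ℂ V)) ℂ :=
    ((LinearMap.toMatrixAlgEquiv b).toAlgHom.toRingHom.toMonoidHom).comp ρ
  have hchar : ∀ s : G, ρ.character s = (R s).trace := fun s => by
    rw [Representation.character, LinearMap.trace_eq_matrix_trace ℂ b]
    rfl
  obtain ⟨u, hu⟩ := exists_conj_unitary R
  let M : G →* Matrix (Fin (finrank ℂ V)) (Fin (finrank ℂ V)) ℂ :=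
    { toFun := fun s => (u : Matrix _ _ ℂ) * R s * ((u⁻¹ : (Matrix _ _ ℂ)ˣ) : Matrix _ _ ℂ)
      map_one' := by simp
      map_mul' := fun a c => by
        simp only [map_mul, Matrix.mul_assoc, Units.inv_mul_cancel_left] }
  have hM : ∀ s, M s = (u : Matrix _ _ ℂ) * R s * ((u⁻¹ : (Matrix _ _ ℂ)ˣ) : Matrix _ _ ℂ) :=
    fun s => rfl
  have htrM : ∀ s, (M s).trace = ρ.character s := fun s => by
    rw [hchar, hM, Matrix.trace_units_conj]
  have hMinv : ∀ t, M t⁻¹ = (M t)ᴴ := fun t => by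
    have h1 : (M t)ᴴ * M t = 1 := by rw [hM]; exact hu t
    have hMmul : M t⁻¹ * M t = 1 := by rw [← map_mul, inv_mul_cancel, map_one]
    calc M t⁻¹ = M t⁻¹ * (M t * (M t)ᴴ) := by rw [mul_eq_one_comm.1 h1, Matrix.mul_one]
      _ = (M t⁻¹ * M t) * (M t)ᴴ := by rw [Matrix.mul_assoc]
      _ = (M t)ᴴ := by rw [hMmul, Matrix.one_mul]
  set A : Matrix (Fin (finrank ℂ V)) (Fin (finrank ℂ V)) ℂ := ∑ y : G, f y • M y with hA
  have hAH : Aᴴ = ∑ x : G, (starRingEnd ℂ) (f x) • M x⁻¹ := by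
    rw [hA, Matrix.conjTranspose_sum]
    refine Finset.sum_congr rfl fun x _ => ?_
    rw [Matrix.conjTranspose_smul, hMinv]
    rfl
  have key : (Aᴴ * A).trace =
      ∑ x : G, ∑ y : G, (starRingEnd ℂ) (f x) * f y * ρ.character (x⁻¹ * y) := by
    rw [hAH, hA, Finset.sum_mul_sum, Matrix.trace_sum]
    refine Finset.sum_congr rfl fun x _ => ?_
    rw [Matrix.trace_sum]
    refine Finset.sum_congr rfl fun y _ => ?_
    rw [Matrix.smul_mul, Matrix.mul_smul, smul_smul, ← map_mul, Matrix.trace_smul, htrM,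
      smul_eq_mul]
  rw [← key]
  exact re_trace_conjTranspose_mul_self_nonneg A

end Positivity

section PermChar

variable {G : Type} [Group G] {Ω : Type} [Fintype Ω] [DecidableEq Ω] [MulAction G Ω]

-- adapted from `character_leftRegular` (IrreducibleCharacters.lean)
/-- **The permutation character counts fixed points**: the character of the permutation
representation `ℂ[Ω]` of a `G`-set `Ω` at `g` is `#{ω : g • ω = ω}`. [folklore] -/
theorem umvirateParseval_character_ofMulAction (g : G) :
    (Representation.ofMulAction ℂ G Ω).character g =
      ((univ.filter fun ω : Ω => g • ω = ω).card : ℂ) := by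
  rw [Representation.character, LinearMap.trace_eq_matrix_trace ℂ (MonoidAlgebra.basis Ω ℂ),
    Matrix.trace]
  simp only [Matrix.diag_apply, LinearMap.toMatrix_apply, MonoidAlgebra.basis_apply,
    Representation.ofMulAction_single]
  have hrepr : ∀ ω : Ω,
      ((MonoidAlgebra.basis Ω ℂ).repr (MonoidAlgebra.single (g • ω) (1 : ℂ))) ω =
        if g • ω = ω then 1 else 0 := fun ω => by
    rw [← MonoidAlgebra.basis_apply, Basis.repr_self, Finsupp.single_apply]
  simp only [hrepr, Finset.sum_boole]

end PermChar

/-! ### Double counting: `Σ_{a,b} |f(U_{a→b})|² = Σ_{x,y} f̄(x) f(y) ψ(x⁻¹y)` -/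

section DoubleCounting

variable {G : Type} [Group G] [Fintype G] {Ω : Type} [Fintype Ω] [DecidableEq Ω] [MulAction G Ω]

/-- **Double counting**: for a finite `G`-set `Ω`,
`Σ_{a,b ∈ Ω} |Σ_{σ : σ • a = b} f(σ)|² = Σ_{x,y ∈ G} f̄(x) f(y) ψ(x⁻¹y)` where
`ψ(g) = #{a : g • a = a}` is the permutation character: expand the squares and note that for fixed
`x, y` the pairs `(a, b)` with `x • a = b = y • a` are the `a` fixed by `x⁻¹y`. [folklore] -/
theorem umvirateParseval_sum_norm_sq_eq (f : G → ℂ) :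
    (((∑ a : Ω, ∑ b : Ω, ‖∑ σ ∈ univ.filter (fun σ : G => σ • a = b), f σ‖ ^ 2 : ℝ)) : ℂ) =
      ∑ x : G, ∑ y : G, (starRingEnd ℂ) (f x) * f y *
        ((univ.filter fun a : Ω => (x⁻¹ * y) • a = a).card : ℂ) := by
  have hsq : ∀ z : ℂ, ((‖z‖ ^ 2 : ℝ) : ℂ) = (starRingEnd ℂ) z * z := fun z => by
    rw [mul_comm, Complex.mul_conj, Complex.normSq_eq_norm_sq]
  -- each term: `S̄_{ab} S_{ab} = Σ_{x,y} [x • a = b][y • a = b] f̄(x) f(y)`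
  have hterm : ∀ a b : Ω, ((‖∑ σ ∈ univ.filter (fun σ : G => σ • a = b), f σ‖ ^ 2 : ℝ) : ℂ) =
      ∑ x : G, ∑ y : G, if x • a = b ∧ y • a = b then (starRingEnd ℂ) (f x) * f y else 0 := by
    intro a b
    rw [hsq, map_sum, Finset.sum_filter, Finset.sum_filter, Finset.sum_mul_sum]
    exact Finset.sum_congr rfl fun x _ => Finset.sum_congr rfl fun y _ =>
      ite_zero_mul_ite_zero _ _ _ _
  -- summing over `b` leaves the condition `y • a = x • a`, i.e. `(x⁻¹y) • a = a`
  have hb : ∀ (a : Ω) (x y : G),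
      (∑ b : Ω, if x • a = b ∧ y • a = b then (starRingEnd ℂ) (f x) * f y else 0) =
        if (x⁻¹ * y) • a = a then (starRingEnd ℂ) (f x) * f y else 0 := by
    intro a x y
    simp_rw [ite_and]
    rw [Finset.sum_ite_eq, if_pos (mem_univ _)]
    exact if_congr (by rw [mul_smul, inv_smul_eq_iff]) rfl rfl
  rw [Complex.ofReal_sum]
  calc ∑ a : Ω, ((∑ b : Ω, ‖∑ σ ∈ univ.filter (fun σ : G => σ • a = b), f σ‖ ^ 2 : ℝ) : ℂ)
      = ∑ a : Ω, ∑ x : G, ∑ y : G,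
          if (x⁻¹ * y) • a = a then (starRingEnd ℂ) (f x) * f y else 0 := by
        refine Finset.sum_congr rfl fun a _ => ?_
        rw [Complex.ofReal_sum, Finset.sum_congr rfl fun b _ => hterm a b, Finset.sum_comm]
        refine Finset.sum_congr rfl fun x _ => ?_
        rw [Finset.sum_comm]
        exact Finset.sum_congr rfl fun y _ => hb a x y
    _ = ∑ x : G, ∑ y : G, ∑ a : Ω,
          if (x⁻¹ * y) • a = a then (starRingEnd ℂ) (f x) * f y else 0 := by
        rw [Finset.sum_comm]
        exact Finset.sum_congr rfl fun x _ => Finset.sum_comm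
    _ = ∑ x : G, ∑ y : G, (starRingEnd ℂ) (f x) * f y *
          ((univ.filter fun a : Ω => (x⁻¹ * y) • a = a).card : ℂ) := by
        refine Finset.sum_congr rfl fun x _ => Finset.sum_congr rfl fun y _ => ?_
        rw [← Finset.sum_filter, Finset.sum_const, nsmul_eq_mul, mul_comm]

end DoubleCounting

/-- A class function on `𝔖ₙ` is `Σ_{μ ⊢ n} ⟨F, χ^μ⟩ χ^μ` (completeness of the irreducible
characters, indexed by partitions). [folklore] -/
theorem umvirateParseval_classFun_eq_sum {n : ℕ} {F : Equiv.Perm (Fin n) → ℂ}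
    (hF : IsClassFun F) :
    F = ∑ μ : Nat.Partition n, classInner F (spechtCharacter ℂ μ) • spechtCharacter ℂ μ := by
  classical
  conv_lhs => rw [hF.eq_sum_classInner_smul, irrChars_toFinset_perm_eq]
  rw [Finset.sum_image fun μ _ ν _ h => spechtCharacter_injective h]

section Multiplicity

variable {n : ℕ}

-- adapted from `EllisFriedgutPilpel2011.fixSum_mul_rowSymmetrizer` (the inner `habs`)
/-- Left absorption `p · a_ν = a_ν` for `p` in the row group (Fulton–Harris, Lemma 4.21 (1)).
[folklore] -/
theorem umvirateParseval_of_mul_rowSymmetrizer {ν : Nat.Partition n} {p : Equiv.Perm (Fin n)}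
    (hp : p ∈ rowStabilizer ν) :
    MonoidAlgebra.of ℂ _ p * rowSymmetrizer ℂ ν = rowSymmetrizer ℂ ν := by
  classical
  unfold Literature.NumberTheory.DiophantineGeometry.rowSymmetrizer
  rw [Finset.mul_sum]
  refine Finset.sum_equiv (Equiv.mulLeft p) (fun σ => ?_) (fun σ _ => ?_)
  · simp only [Equiv.coe_mulLeft, Set.mem_toFinset, SetLike.mem_coe]
    exact ⟨fun h => mul_mem hp h, fun h => by simpa using mul_mem (inv_mem hp) h⟩
  · rw [Equiv.coe_mulLeft, map_mul]

open Summit.MatrixMultiplication.MatrixMultiplication.Theorems.LevelOneLink in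
/-- **Young's rule, lower bound** (Ellis–Friedgut–Pilpel 2011, proof of Thm. 7: "`V_{[λ]} ≤ V`
for all `λ ≥ (n-k,1^k)`"): if `ν₁ ≥ n - ℓ` then `S^ν` is an equivariant quotient of the
permutation module `ℂ[Ω_ℓ]` on injective `ℓ`-tuples, so `dim S^ν ≤ rk P_{χ^ν}(ℂ[Ω_ℓ])`: with `B`
a set of `n - ℓ` entries of the first row of the canonical tableau and `a` enumerating `Bᶜ`, the
stabiliser of `a` consists of row permutations, which fix the Young symmetrizer `c_ν ≠ 0`, and the
orbit map of `c_ν` is onto the irreducible `S^ν`. [folklore] -/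
theorem umvirateParseval_finrank_le_rank (ℓ : ℕ) (hℓ : ℓ ≤ n) (ν : Nat.Partition n)
    (hν : n - ℓ ≤ ν.parts.sup) :
    finrank ℂ (spechtIdeal ℂ ν) ≤ finrank ℂ (LinearMap.range
      (isotypicProj (Representation.ofMulAction ℂ (Equiv.Perm (Fin n)) (Fin ℓ ↪ Fin n))
        (spechtCharacter ℂ ν))) := by
  classical
  -- `n - ℓ` entries `B` of the first row of `T_ν`; `C = Bᶜ` has `ℓ` elements
  obtain ⟨B, hB, hBcard⟩ := Finset.exists_subset_card_eq
    (le_trans hν (EllisFriedgutPilpel2011.sup_parts_le_card_filter_rowOf_eq_zero ν))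
  set C : Finset (Fin n) := Bᶜ with hCdef
  have hCcard : C.card = ℓ := by
    rw [hCdef, Finset.card_compl, hBcard, Fintype.card_fin]
    omega
  have hrow : ∀ x ∉ C, ν.rowOf x = 0 := fun x hxC => by
    have hxB : x ∈ B := by
      rw [hCdef, Finset.mem_compl, not_not] at hxC
      exact hxC
    exact (Finset.mem_filter.1 (hB hxB)).2
  -- the injective `ℓ`-tuple `a` enumerating `C`; its stabiliser fixes `C` pointwise
  set a : Fin ℓ ↪ Fin n := (C.orderEmbOfFin hCcard).toEmbedding with hadef
  have ha : ∀ h : Equiv.Perm (Fin n), h • a = a → ∀ x ∈ C, h x = x := by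
    intro h hh x hxC
    have hxr : x ∈ Set.range (C.orderEmbOfFin hCcard) := by
      rw [Finset.range_orderEmbOfFin]
      exact hxC
    obtain ⟨i, rfl⟩ := hxr
    have hi := congrArg (fun e : Fin ℓ ↪ Fin n => e i) hh
    simp only [Function.Embedding.smul_apply, Equiv.Perm.smul_def, hadef,
      RelEmbedding.coe_toEmbedding] at hi
    exact hi
  -- the Young symmetrizer is a non-zero `Stab(a)`-fixed vector of the irreducible `S^ν`
  set w : spechtIdeal ℂ ν := ⟨youngSymmetrizer ℂ ν, youngSymmetrizer_mem_spechtIdeal ℂ ν⟩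
  have hw0 : w ≠ 0 := fun h => youngSymmetrizer_ne_zero_holds ℂ ν (congrArg Subtype.val h)
  have hw : ∀ h : Equiv.Perm (Fin n), h • a = a → spechtRep ℂ ν h w = w := fun h hh => by
    apply Subtype.ext
    rw [spechtRep_apply]
    show MonoidAlgebra.of ℂ _ h * youngSymmetrizer ℂ ν = youngSymmetrizer ℂ ν
    rw [Literature.NumberTheory.DiophantineGeometry.youngSymmetrizer, ← mul_assoc,
      umvirateParseval_of_mul_rowSymmetrizer
        (EllisFriedgutPilpel2011.mem_rowStabilizer_of_fix ν C hrow (ha h hh))]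
  haveI : (spechtRep ℂ ν).IsIrreducible := isIrreducible_spechtRep_holds ν
  haveI : Module.Finite ℂ (MonoidAlgebra ℂ (Fin ℓ ↪ Fin n)) :=
    Module.Finite.of_basis (MonoidAlgebra.basis (Fin ℓ ↪ Fin n) ℂ)
  -- the orbit map `ℂ[Ω_ℓ] ↠ S^ν`
  let Φ : (Representation.ofMulAction ℂ (Equiv.Perm (Fin n)) (Fin ℓ ↪ Fin n)).IntertwiningMap
      (spechtRep ℂ ν) :=
    ⟨(MonoidAlgebra.basis (Fin ℓ ↪ Fin n) ℂ).constr ℂ (fun u : Fin ℓ ↪ Fin n =>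
        ∑ g : Equiv.Perm (Fin n), if g • a = u then spechtRep ℂ ν g w else 0),
      fun x => orbitMap_intertwining (spechtRep ℂ ν) a w x⟩
  exact finrank_le_finrank_range_isotypicProj _ (spechtRep ℂ ν) Φ
    (orbitMap_surjective (spechtRep ℂ ν) a hw0 hw) rfl

/-- **The multiplicities `⟨ψ_ℓ, χ^ν⟩` of the permutation character `ψ_ℓ` of `𝔖ₙ` on injective
`ℓ`-tuples** are non-negative reals (`χ^ν(1) ⟨χ^ν, ψ_ℓ⟩ = tr P_{χ^ν} = rk P_{χ^ν}` for the
idempotent isotypic projector), and `≥ 1` when `ν₁ ≥ n - ℓ`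
(`umvirateParseval_finrank_le_rank`: `rk P_{χ^ν} ≥ dim S^ν = χ^ν(1)`). [folklore] -/
theorem umvirateParseval_classInner_coeff (ℓ : ℕ) (hℓ : ℓ ≤ n) (ν : Nat.Partition n) :
    ∃ c : ℝ, 0 ≤ c ∧
      classInner (Representation.ofMulAction ℂ (Equiv.Perm (Fin n)) (Fin ℓ ↪ Fin n)).character
        (spechtCharacter ℂ ν) = (c : ℂ) ∧
      (n - ℓ ≤ ν.parts.sup → 1 ≤ c) := by
  classical
  haveI : Module.Finite ℂ (MonoidAlgebra ℂ (Fin ℓ ↪ Fin n)) :=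
    Module.Finite.of_basis (MonoidAlgebra.basis (Fin ℓ ↪ Fin n) ℂ)
  set P := Representation.ofMulAction ℂ (Equiv.Perm (Fin n)) (Fin ℓ ↪ Fin n)
  have hidem : IsIdempotentElem (isotypicProj P (spechtCharacter ℂ ν)) := by
    change isotypicProj P _ * isotypicProj P _ = isotypicProj P _
    rw [Module.End.mul_eq_comp, isotypicProj_comp_self P (isIrrChar_spechtCharacter ν)]
  have htr := (LinearMap.IsIdempotentElem.isProj_range _ hidem).trace
  rw [trace_isotypicProj] at htr
  set r := finrank ℂ (LinearMap.range (isotypicProj P (spechtCharacter ℂ ν)))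
  set d := finrank ℂ (spechtIdeal ℂ ν) with hd
  have hd1 : spechtCharacter ℂ ν 1 = (d : ℂ) := (spechtRep ℂ ν).char_one
  have hdpos : 0 < d := by
    rw [hd, Module.finrank_pos_iff_exists_ne_zero]
    exact ⟨⟨youngSymmetrizer ℂ ν, youngSymmetrizer_mem_spechtIdeal ℂ ν⟩,
      fun h => youngSymmetrizer_ne_zero_holds ℂ ν (congrArg Subtype.val h)⟩
  have hd0 : (d : ℂ) ≠ 0 := Nat.cast_ne_zero.2 hdpos.ne'
  refine ⟨(r : ℝ) / d, by positivity, ?_, fun hν => ?_⟩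
  · rw [classInner_comm, Complex.ofReal_div, Complex.ofReal_natCast, Complex.ofReal_natCast,
      eq_div_iff hd0, mul_comm]
    rw [hd1] at htr
    exact htr
  · rw [le_div_iff₀ (by exact_mod_cast hdpos), one_mul]
    exact_mod_cast umvirateParseval_finrank_le_rank ℓ hℓ ν hν

end Multiplicity

/-- **The umvirate Parseval inequality** (Young's rule content): for `ℓ ≤ n` and every
coefficient function `f` on `𝔖ₙ`, the mass of `f` on the irreducibles `S^μ`, `μ ≠ (n)`,
`μ₁ ≥ n - ℓ`, written as the character sums `Re Σ_{x,y} f̄(x) f(y) χ^μ(x⁻¹y)`, is at most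
`Σ_{I,L} |f(U_{I→L})|² - |f(𝔖ₙ)|²` over the `ℓ`-umvirates `U_{I→L} = {σ : σ ∘ I = L}`
(`Σ_{I,L} |f(U_{I→L})|² = Σ_ν ⟨ψ_ℓ, χ^ν⟩ Re Σ_{x,y} f̄ f χ^ν` for the permutation character `ψ_ℓ`
on injective `ℓ`-tuples, with `⟨ψ_ℓ, χ^ν⟩ ≥ 0`, `≥ 1` for `ν₁ ≥ n - ℓ`, and all character sums
`≥ 0`; see the module docstring). -/
theorem stub_umvirateParseval (n ℓ : ℕ) (hℓ : ℓ ≤ n) (f : Equiv.Perm (Fin n) → ℂ) :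
    (∑ μ ∈ univ.filter (fun μ : Nat.Partition n =>
        μ ≠ Nat.Partition.indiscrete n ∧ n - ℓ ≤ μ.parts.sup),
      (∑ x : Equiv.Perm (Fin n), ∑ y : Equiv.Perm (Fin n),
        (starRingEnd ℂ) (f x) * f y * spechtCharacter ℂ μ (x⁻¹ * y)).re) ≤
      (∑ I : Fin ℓ ↪ Fin n, ∑ L : Fin ℓ ↪ Fin n,
          ‖∑ σ ∈ univ.filter (fun σ : Equiv.Perm (Fin n) => ∀ k, σ (I k) = L k), f σ‖ ^ 2) -
        ‖∑ σ : Equiv.Perm (Fin n), f σ‖ ^ 2 := by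
  classical
  -- the character sums `B μ` and the permutation representation `P` on injective `ℓ`-tuples
  set B : Nat.Partition n → ℂ := fun μ => ∑ x : Equiv.Perm (Fin n), ∑ y : Equiv.Perm (Fin n),
    (starRingEnd ℂ) (f x) * f y * spechtCharacter ℂ μ (x⁻¹ * y) with hB
  haveI : Module.Finite ℂ (MonoidAlgebra ℂ (Fin ℓ ↪ Fin n)) :=
    Module.Finite.of_basis (MonoidAlgebra.basis (Fin ℓ ↪ Fin n) ℂ)
  set P := Representation.ofMulAction ℂ (Equiv.Perm (Fin n)) (Fin ℓ ↪ Fin n)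
  have hBnn : ∀ μ, 0 ≤ (B μ).re := fun μ => umvirateParseval_re_charSum_nonneg (spechtRep ℂ μ) f
  -- (1) double counting: `Σ_{I,L} |f(U_{I→L})|² = Re Σ_{x,y} f̄(x) f(y) ψ(x⁻¹y)`
  have h1 : (∑ I : Fin ℓ ↪ Fin n, ∑ L : Fin ℓ ↪ Fin n,
      ‖∑ σ ∈ univ.filter (fun σ : Equiv.Perm (Fin n) => ∀ k, σ (I k) = L k), f σ‖ ^ 2) =
      (∑ x : Equiv.Perm (Fin n), ∑ y : Equiv.Perm (Fin n),
        (starRingEnd ℂ) (f x) * f y * P.character (x⁻¹ * y)).re := by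
    have hU : ∀ I L : Fin ℓ ↪ Fin n,
        (univ.filter fun σ : Equiv.Perm (Fin n) => ∀ k, σ (I k) = L k) =
          univ.filter fun σ : Equiv.Perm (Fin n) => σ • I = L := fun I L =>
      Finset.filter_congr fun σ _ => by
        rw [Function.Embedding.ext_iff]
        simp only [Function.Embedding.smul_apply, Equiv.Perm.smul_def]
    have h := congrArg Complex.re (umvirateParseval_sum_norm_sq_eq (Ω := Fin ℓ ↪ Fin n) f)
    simp only [← umvirateParseval_character_ofMulAction, Complex.ofReal_re] at h
    rw [← h]
    exact Finset.sum_congr rfl fun I _ => Finset.sum_congr rfl fun L _ => by rw [hU]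
  -- (2) `|f(𝔖ₙ)|² = Re B (n)` since `χ^{(n)} = 1`
  have h2 : ‖∑ σ : Equiv.Perm (Fin n), f σ‖ ^ 2 = (B (Nat.Partition.indiscrete n)).re := by
    simp only [hB, Literature.Barriers.ValiantsHypothesis.spechtCharacter_indiscrete, mul_one]
    rw [← Finset.sum_mul_sum, ← map_sum, mul_comm, Complex.mul_conj, Complex.normSq_eq_norm_sq,
      Complex.ofReal_re]
  -- (3) `ψ = Σ_ν c_ν χ^ν` with `c_ν ≥ 0`, `c_ν ≥ 1` for `ν₁ ≥ n - ℓ`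
  have hψ := umvirateParseval_classFun_eq_sum (F := P.character) fun s t => P.char_conj s t
  choose c hc0 hc hc1 using fun ν => umvirateParseval_classInner_coeff (n := n) ℓ hℓ ν
  have hc' : ∀ ν, classInner P.character (spechtCharacter ℂ ν) = (c ν : ℂ) := hc
  have hψ' : ∀ g, P.character g = ∑ ν, (c ν : ℂ) * spechtCharacter ℂ ν g := fun g => by
    conv_lhs => rw [hψ]
    simp only [Finset.sum_apply, Pi.smul_apply, smul_eq_mul, hc']
  -- (4) `Σ_{x,y} f̄(x) f(y) ψ(x⁻¹y) = Σ_ν c_ν B ν`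
  have h4 : (∑ x : Equiv.Perm (Fin n), ∑ y : Equiv.Perm (Fin n),
      (starRingEnd ℂ) (f x) * f y * P.character (x⁻¹ * y)) = ∑ ν, (c ν : ℂ) * B ν := by
    simp only [hψ', Finset.mul_sum, hB]
    calc ∑ x : Equiv.Perm (Fin n), ∑ y : Equiv.Perm (Fin n), ∑ ν : Nat.Partition n,
          (starRingEnd ℂ) (f x) * f y * ((c ν : ℂ) * spechtCharacter ℂ ν (x⁻¹ * y))
        = ∑ x : Equiv.Perm (Fin n), ∑ ν : Nat.Partition n, ∑ y : Equiv.Perm (Fin n),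
          (starRingEnd ℂ) (f x) * f y * ((c ν : ℂ) * spechtCharacter ℂ ν (x⁻¹ * y)) :=
          Finset.sum_congr rfl fun x _ => Finset.sum_comm
      _ = ∑ ν : Nat.Partition n, ∑ x : Equiv.Perm (Fin n), ∑ y : Equiv.Perm (Fin n),
          (c ν : ℂ) * ((starRingEnd ℂ) (f x) * f y * spechtCharacter ℂ ν (x⁻¹ * y)) := by
          rw [Finset.sum_comm]
          refine Finset.sum_congr rfl fun ν _ => Finset.sum_congr rfl fun x _ =>
            Finset.sum_congr rfl fun y _ => ?_
          ring
  -- (5) drop the `ν` with `ν₁ < n - ℓ` and the factors `c_ν ≥ 1`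
  have h5 : ∑ μ ∈ univ.filter (fun μ : Nat.Partition n => n - ℓ ≤ μ.parts.sup), (B μ).re ≤
      (∑ ν, (c ν : ℂ) * B ν).re := by
    rw [Complex.re_sum]
    simp only [Complex.re_ofReal_mul]
    calc ∑ μ ∈ univ.filter (fun μ : Nat.Partition n => n - ℓ ≤ μ.parts.sup), (B μ).re
        ≤ ∑ μ ∈ univ.filter (fun μ : Nat.Partition n => n - ℓ ≤ μ.parts.sup), c μ * (B μ).re :=
          Finset.sum_le_sum fun μ hμ =>
            le_mul_of_one_le_left (hBnn μ) (hc1 μ (Finset.mem_filter.1 hμ).2)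
      _ ≤ ∑ ν, c ν * (B ν).re :=
          Finset.sum_le_sum_of_subset_of_nonneg (Finset.filter_subset _ _)
            fun ν _ _ => mul_nonneg (hc0 ν) (hBnn ν)
  -- (6) `(n)` belongs to the family `ν₁ ≥ n - ℓ`
  have hmem : n - ℓ ≤ (Nat.Partition.indiscrete n).parts.sup := by
    rcases Nat.eq_zero_or_pos n with hn | hn
    · simp [hn]
    · rw [Nat.Partition.indiscrete_parts hn.ne', Multiset.sup_singleton]
      exact Nat.sub_le n ℓ
  have hsplit : ∑ μ ∈ univ.filter (fun μ : Nat.Partition n => n - ℓ ≤ μ.parts.sup), (B μ).re =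
      (∑ μ ∈ univ.filter (fun μ : Nat.Partition n =>
          μ ≠ Nat.Partition.indiscrete n ∧ n - ℓ ≤ μ.parts.sup), (B μ).re) +
        (B (Nat.Partition.indiscrete n)).re := by
    have hF : univ.filter (fun μ : Nat.Partition n =>
        μ ≠ Nat.Partition.indiscrete n ∧ n - ℓ ≤ μ.parts.sup) =
        (univ.filter fun μ : Nat.Partition n => n - ℓ ≤ μ.parts.sup).erase
          (Nat.Partition.indiscrete n) := by
      ext μ
      simp only [Finset.mem_filter, Finset.mem_univ, true_and, Finset.mem_erase]
    rw [hF, Finset.sum_erase_add _ _ (Finset.mem_filter.2 ⟨Finset.mem_univ _, hmem⟩ :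
      Nat.Partition.indiscrete n ∈ univ.filter fun μ : Nat.Partition n => n - ℓ ≤ μ.parts.sup)]
  rw [h1, h2, h4]
  linarith [h5, hsplit]

end Summit.MatrixMultiplication.MatrixMultiplication.Theorems.GlobalBranch
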